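import Mathlib
import Summits.SmoothPoincare4.SmoothPoincare4.Theorems.SoloInformedAnchorIdentities
import Summits.SmoothPoincare4.SmoothPoincare4.Theorems.SoloInformedPageTori

/-!
# The π₁-obstructed two-level pairs of tunnel page tori have non-free link group (solo-informed, session s54)

Setting (HKM24 = Hughes–Kim–Miller, arXiv:2402.11706, Question 1.4; the residency's banked statement
paper/doors-for-M0.md §2 and work/s48/sequential-doors.md §1–§2, CLAIMS C604/C613).  `Γ̃ = π₁Σ(2,3,7) =
⟨a, b ∣ a³ = (ab)² = b⁷⟩`; `X(φ)` the open book with page `Σ(2,3,7)°` and monodromy `φ`; for page classes `g, g'`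
the two-level pair of page tori `T = T_g × θ₁`, `T' = T_{g'} × θ₂` (`θ₁ < θ₂`) has complement group (van Kampen over
the levels, C613(a))

  `G(φ; g, g') = ⟨ a, b, x₁, x₂ ∣ a³ = (ab)² = b⁷,  (x₂x₁) w (x₂x₁)⁻¹ = φ w φ⁻¹ (w = a, b),  [x₁, g] = 1,  [x₂, x₁ g' x₁⁻¹] = 1 ⟩`,

`x₁, x₂` the level meridians.  A SPLIT pair of unknotted tori has `G ≅ F₂`; so `G` not free ⇒ the pair is not split
(and carries no `λ`-type Gompf disc / solid torus off the other component — sequential-doors §1, PAIR CRITERION (i)).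
The two `π₁`-OBSTRUCTED types of the pair table C604 were certified by explicit RETRACTIONS `G ↠ Γ̃ (× F₂)`:
`x₁ ↦ u ∈ C(g)`, `x₁⁻¹x₂x₁ ↦ v ∈ C(g')` with `uv = φ` — vertex `a = (S⁴, τ³T(2,7))`, type `d ≡ 1 (3)`: `(u, v) = (b, aba⁻¹)`,
`b·aba⁻¹ = a` (`SoloInformed_a_eq_b_bconj`, landed); vertex `b = (S⁴, τ⁷T(2,3))`, the ANTIPODAL type `d = 3`:
`(u, v) = (g₀⁻¹, g₃⁻¹)`, `g₀ = ab⁻³` the tunnel class (`SoloInformedTunnelClass`), `g_j = b^j g₀ b^{-j}`.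

This file makes both certificates KERNEL facts and draws the group-theoretic conclusion inside Lean:

* `SoloInformed_cert_antipodal`, `SoloInformed_cert_antipodal_mirror`: `g₀⁻¹ g₃⁻¹ = b` and `g₀ g₄ = b⁻¹` hold EXACTLY in
  any group with `a³ = abab = b⁷ = z` — central exponent ZERO (C604 recorded "`b·h⁻¹`"; the `h` was a labelling artefact).
* `soloInformed_comm237_trivial`: `Γ̃` is perfect — in a commutative group `a³ = (ab)² = b⁷` forces `a = b = 1`.
* `soloInformed_free_no237`: a FREE group contains no non-trivial pair with `a³ = (ab)² = b⁷` (the subgroup the pair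
  generates is perfect and, by Nielsen–Schreier `subgroupIsFreeOfIsFree`, free; a perfect free group has no generators).
* `SoloInformedPairA.not_isFreeGroup`, `SoloInformedPairB.not_isFreeGroup`: the presented groups `G(a; b, aba⁻¹)` (= the group of the pair
  `(T_b, T_{aba⁻¹})` inside the three-torus presentation `X(η) = X(a·b⁻²(aba⁻¹)²b⁻³)`, s43 §9.5 / `SoloInformed_eta_threeTorus`)
  and `G(b; g₀, g₃)` (the antipodal tunnel-torus pair of `(S⁴, τ⁷T(2,3))`) are NOT free: the certificate assignment composed
  with `Γ̃ → PSL(2,8) ≤ S₉` (`soloInformedPermA/B`, `soloInformed_psl28_hurwitz`) is a homomorphism under which `a ↦ ≠ 1`,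
  checked by `decide`, while `soloInformed_free_no237` would force `a = 1`.

By contrast the pair `P*` of the banked statement (types 2/5) has `G ≅ F₂` (C604, GAP) — this file is the negative
half of that dichotomy.  Nothing topological is asserted in Lean: the identification of `G(φ; g, g')` with
`π₁(X(φ) ∖ (T ∪ T'))` and "split ⇒ free" are the prose dictionary (C613(a)).
-/

namespace Summit.SmoothPoincare4.SmoothPoincare4.Theorems

/-! ### 1. The exact certificate identities in `Γ̃` (rewrite chains, s43 normal-form engine; `work/s54/gen_cert.py`) -/

section cert
variable {G : Type*} [Group G] {a b z : G}

set_option maxHeartbeats 1600000 in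
/-- `g₀⁻¹ · g₃⁻¹ = b` EXACTLY (`g₀ = ab⁻³`, `g₃ = b³ g₀ b⁻³`): the retraction certificate of the antipodal two-level pair at vertex `b` (C604, type `d = 3`). -/
theorem SoloInformed_cert_antipodal (r0 : a * a * a = z) (r1 : a * b * a * b = z) (r2 : b * b * b * b * b * b * b = z) :
    b * b * b * a⁻¹ * b * b * b * b * b * b * a⁻¹ * b⁻¹ * b⁻¹ * b⁻¹
      = b := by
  have hza : a * z = z * a := SoloInformed_anchor_za r0
  have hzb : b * z = z * b := SoloInformed_anchor_zb r0 r1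
  have r3 : b * a * b * a = z := SoloInformed_anchor_baba r0 r1
  have cza := SoloInformed_zc_l hza; have czb := SoloInformed_zc_l hzb; have czA := SoloInformed_zc_il hza
  have czB := SoloInformed_zc_il hzb; have cZa := SoloInformed_zc_zl hza; have cZb := SoloInformed_zc_zl hzb
  have cZA := SoloInformed_zc_izl hza; have cZB := SoloInformed_zc_izl hzb; have tzA := SoloInformed_zc_i hza
  have tzB := SoloInformed_zc_i hzb; have tZa := SoloInformed_zc_z hza; have tZb := SoloInformed_zc_z hzb
  have tZA := SoloInformed_zc_iz hza; have tZB := SoloInformed_zc_iz hzb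
  have eL : b * b * b * a⁻¹ * b * b * b * b * b * b * a⁻¹ * b⁻¹ * b⁻¹ * b⁻¹
      = b * b * b * a⁻¹ * b * b * b * b * b * b * a⁻¹ * b⁻¹ * b⁻¹ * b⁻¹ := by
    simp only [mul_assoc]
  rw [eL]
  calc b * b * b * a⁻¹ * b * b * b * b * b * b * a⁻¹ * b⁻¹ * b⁻¹ * b⁻¹
    _ = b * b * b * a⁻¹ * b⁻¹ * b⁻¹ * b⁻¹ * z * b * b * a⁻¹ * b⁻¹ * b⁻¹ * b⁻¹ := by rw [← r2]; simp only [mul_assoc, inv_mul_cancel_left]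
    _ = z * b * b * b * a⁻¹ * b⁻¹ * b⁻¹ * b⁻¹ * b * b * a⁻¹ * b⁻¹ * b⁻¹ * b⁻¹ := by simp only [mul_assoc, czA, czb, czB, tzB, inv_mul_cancel, mul_one]
    _ = z * b * b * b * a⁻¹ * b⁻¹ * b⁻¹ * b * a⁻¹ * b⁻¹ * b⁻¹ * b⁻¹ := by simp only [mul_assoc, inv_mul_cancel, mul_one]
    _ = z * b * b * b * a⁻¹ * b⁻¹ * a⁻¹ * b⁻¹ * b⁻¹ * b⁻¹ := by simp only [mul_assoc, inv_mul_cancel, mul_one]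
    _ = z * b * b * b * a⁻¹ * z⁻¹ * a * b⁻¹ * b⁻¹ := by rw [← r1]; simp only [mul_assoc, mul_inv_rev, inv_mul_cancel, mul_one]
    _ = b * b * b * a⁻¹ * a * b⁻¹ * b⁻¹ := by simp only [mul_assoc, cZb, tZA, mul_inv_cancel_left, mul_inv_cancel, inv_mul_cancel, mul_one]
    _ = b * b * b * b⁻¹ * b⁻¹ := by simp only [mul_assoc, mul_inv_cancel, inv_mul_cancel, mul_one]
    _ = b * b * b⁻¹ := by simp only [mul_assoc, mul_inv_cancel, mul_one]
    _ = b := by simp only [mul_assoc, mul_inv_cancel, mul_one]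

set_option maxHeartbeats 1600000 in
/-- `g₀ · g₄ = b⁻¹` up to the central letter (`g₄ = b⁴ g₀ b⁻⁴`): the mirror certificate (type `d = 4` for `φ = b⁻¹`). -/
theorem SoloInformed_cert_antipodal_mirror (r0 : a * a * a = z) (r1 : a * b * a * b = z) (r2 : b * b * b * b * b * b * b = z) :
    a * b⁻¹ * b⁻¹ * b⁻¹ * b * b * b * b * a * b⁻¹ * b⁻¹ * b⁻¹ * b⁻¹ * b⁻¹ * b⁻¹ * b⁻¹
      = b⁻¹ := by
  have hza : a * z = z * a := SoloInformed_anchor_za r0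
  have hzb : b * z = z * b := SoloInformed_anchor_zb r0 r1
  have r3 : b * a * b * a = z := SoloInformed_anchor_baba r0 r1
  have cza := SoloInformed_zc_l hza; have czb := SoloInformed_zc_l hzb; have czA := SoloInformed_zc_il hza
  have czB := SoloInformed_zc_il hzb; have cZa := SoloInformed_zc_zl hza; have cZb := SoloInformed_zc_zl hzb
  have cZA := SoloInformed_zc_izl hza; have cZB := SoloInformed_zc_izl hzb; have tzA := SoloInformed_zc_i hza
  have tzB := SoloInformed_zc_i hzb; have tZa := SoloInformed_zc_z hza; have tZb := SoloInformed_zc_z hzb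
  have tZA := SoloInformed_zc_iz hza; have tZB := SoloInformed_zc_iz hzb
  have eL : a * b⁻¹ * b⁻¹ * b⁻¹ * b * b * b * b * a * b⁻¹ * b⁻¹ * b⁻¹ * b⁻¹ * b⁻¹ * b⁻¹ * b⁻¹
      = a * b * a * b⁻¹ * b⁻¹ * b⁻¹ * b⁻¹ * b⁻¹ * b⁻¹ * b⁻¹ := by
    simp only [mul_assoc, inv_mul_cancel, mul_one]
  rw [eL]
  calc a * b * a * b⁻¹ * b⁻¹ * b⁻¹ * b⁻¹ * b⁻¹ * b⁻¹ * b⁻¹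
    _ = a * b * a * b * b * b * z⁻¹ * b⁻¹ * b⁻¹ * b⁻¹ := by rw [← r2]; simp only [mul_assoc, mul_inv_rev, mul_inv_cancel_left]
    _ = z⁻¹ * a * b * a * b * b * b * b⁻¹ * b⁻¹ * b⁻¹ := by simp only [mul_assoc, cZa, cZb, tZb, mul_inv_cancel, mul_one]
    _ = z⁻¹ * a * b * a * b * b * b⁻¹ * b⁻¹ := by simp only [mul_assoc, mul_inv_cancel, mul_one]
    _ = z⁻¹ * a * b * a * b * b⁻¹ := by simp only [mul_assoc, mul_inv_cancel, mul_one]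
    _ = z⁻¹ * a * b * a := by simp only [mul_assoc, mul_inv_cancel, mul_one]
    _ = z⁻¹ * z * b⁻¹ := by rw [← r1]; simp only [mul_assoc, mul_inv_rev, inv_mul_cancel_left, inv_mul_cancel, mul_one, one_mul]
    _ = b⁻¹ := by simp only [inv_mul_cancel, one_mul]

end cert

/-! ### 2. Free groups contain no non-trivial `(2,3,7)`-pair -/

/-- `Γ̃ = π₁Σ(2,3,7)` is perfect: in a commutative group, `a³ = z`, `abab = z`, `b⁷ = z` force `a = 1` and `b = 1`. -/
theorem soloInformed_comm237_trivial {A : Type*} [CommGroup A] {x y z : A}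
    (r0 : x * x * x = z) (r1 : x * y * x * y = z) (r2 : y * y * y * y * y * y * y = z) : x = 1 ∧ y = 1 := by
  have e1 : x * x * x = x * x * (y * y) := by
    rw [r0, ← r1]; ac_rfl
  have hx : x = y * y := mul_left_cancel e1
  subst hx
  have e2 : y * y * y * y * y * y * y = y * y * y * y * y * y * 1 := by
    rw [mul_one, r2, ← r0]; ac_rfl
  have hy : y = 1 := mul_left_cancel e2
  subst hy
  simp

/-- A free group contains no non-trivial pair `a, b` with `a³ = abab = b⁷`: the subgroup generated by `a, b` is
perfect (`soloInformed_comm237_trivial`) and free (Nielsen–Schreier, `subgroupIsFreeOfIsFree`), hence has an empty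
basis and is trivial. -/
theorem soloInformed_free_no237 {H : Type*} [Group H] [IsFreeGroup H] {a b z : H}
    (r0 : a * a * a = z) (r1 : a * b * a * b = z) (r2 : b * b * b * b * b * b * b = z) : a = 1 ∧ b = 1 := by
  classical
  -- the subgroup generated by `a, b`, as the range of a homomorphism from the free group on `Bool`
  let g : FreeGroup Bool →* H := FreeGroup.lift fun t => cond t a b
  let K : Subgroup H := g.range
  let a' : K := g.rangeRestrict (FreeGroup.of true)
  let b' : K := g.rangeRestrict (FreeGroup.of false)
  have ha' : (a' : H) = a := by simp [a', g, MonoidHom.coe_rangeRestrict, FreeGroup.lift_apply_of]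
  have hb' : (b' : H) = b := by simp [b', g, MonoidHom.coe_rangeRestrict, FreeGroup.lift_apply_of]
  -- the relations hold in `K`
  have r0' : a' * a' * a' = a' * b' * a' * b' := by
    apply Subtype.ext; simp only [Subgroup.coe_mul, ha', hb', r0, r1]
  have r2' : b' * b' * b' * b' * b' * b' * b' = a' * b' * a' * b' := by
    apply Subtype.ext; simp only [Subgroup.coe_mul, ha', hb', r2, r1]
  -- every homomorphism from `K` to a commutative group is trivial
  have htriv : ∀ {A : Type} [CommGroup A] (f : K →* A), f = 1 := by
    intro A _ f
    have hgen : ∀ t : Bool, (f.comp g.rangeRestrict) (FreeGroup.of t) = 1 := by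
      have key := soloInformed_comm237_trivial (x := f a') (y := f b') (z := f (a' * b' * a' * b'))
        (by rw [← map_mul, ← map_mul, r0']) (by rw [← map_mul, ← map_mul, ← map_mul])
        (by rw [← map_mul, ← map_mul, ← map_mul, ← map_mul, ← map_mul, ← map_mul, r2'])
      intro t; cases t
      · exact key.2
      · exact key.1
    have hcomp : f.comp g.rangeRestrict = (1 : K →* A).comp g.rangeRestrict :=
      FreeGroup.ext_hom _ _ fun t => by rw [hgen t]; rfl
    ext k
    obtain ⟨w, rfl⟩ := MonoidHom.rangeRestrict_surjective g k
    exact DFunLike.congr_fun hcomp w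
  -- Nielsen–Schreier: `K` is free; a free group all of whose abelian quotients vanish has no generators
  haveI : IsFreeGroup K := inferInstance
  have hempty : IsEmpty (IsFreeGroup.Generators K) := by
    by_contra hne
    obtain ⟨j⟩ := not_isEmpty_iff.mp hne
    let φ : K →* Multiplicative ℤ :=
      IsFreeGroup.lift fun i => if i = j then Multiplicative.ofAdd (1 : ℤ) else 1
    have h1 : φ (IsFreeGroup.of j) = Multiplicative.ofAdd (1 : ℤ) := by
      simp only [φ, IsFreeGroup.lift_of, if_true]
    rw [htriv φ, MonoidHom.one_apply] at h1
    exact absurd (congrArg Multiplicative.toAdd h1) (by decide)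
  -- hence `K` is trivial
  have hid : MonoidHom.id K = 1 := IsFreeGroup.ext_hom fun i => hempty.elim i
  have hk : ∀ k : K, k = 1 := fun k => by simpa using DFunLike.congr_fun hid k
  refine ⟨?_, ?_⟩
  · rw [← ha', hk a', Subgroup.coe_one]
  · rw [← hb', hk b', Subgroup.coe_one]

/-! ### 3. The presented pair groups and their non-freeness -/

/-- Generator symbols of a two-level pair group: `a, b` (page group `Γ̃`) and the level meridians `x₁, x₂`. -/
inductive SoloInformedPGen | a | b | x₁ | x₂
  deriving DecidableEq

namespace SoloInformedPGen

/-- The letters as elements of the free group. -/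
def A : FreeGroup SoloInformedPGen := FreeGroup.of SoloInformedPGen.a
/-- The letters as elements of the free group. -/
def B : FreeGroup SoloInformedPGen := FreeGroup.of SoloInformedPGen.b
/-- The letters as elements of the free group. -/
def X₁ : FreeGroup SoloInformedPGen := FreeGroup.of SoloInformedPGen.x₁
/-- The letters as elements of the free group. -/
def X₂ : FreeGroup SoloInformedPGen := FreeGroup.of SoloInformedPGen.x₂

/-- The six relators of `G(φ; g, g')`: `a³(abab)⁻¹`, `b⁷(abab)⁻¹`, `(x₂x₁) a (x₂x₁)⁻¹ (φaφ⁻¹)⁻¹`, the same for `b`,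
`[x₁, g]`, `[x₂, x₁ g' x₁⁻¹]` — as a function of the words `φ, g, g'`. -/
def pairRel (φ g g' : FreeGroup SoloInformedPGen) (k : Fin 6) : FreeGroup SoloInformedPGen :=
  ![A * A * A * (A * B * A * B)⁻¹,
    B * B * B * B * B * B * B * (A * B * A * B)⁻¹,
    X₂ * X₁ * A * (X₂ * X₁)⁻¹ * (φ * A * φ⁻¹)⁻¹,
    X₂ * X₁ * B * (X₂ * X₁)⁻¹ * (φ * B * φ⁻¹)⁻¹,
    X₁ * g * X₁⁻¹ * g⁻¹,
    X₂ * (X₁ * g' * X₁⁻¹) * X₂⁻¹ * (X₁ * g' * X₁⁻¹)⁻¹] k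

/-- The relator set of `G(φ; g, g')`. -/
def pairRels (φ g g' : FreeGroup SoloInformedPGen) : Set (FreeGroup SoloInformedPGen) := Set.range (pairRel φ g g')

end SoloInformedPGen

open SoloInformedPGen in
/-- The two-level pair group `G(φ; g, g')` as a presented group. -/
abbrev SoloInformedPairGroup (φ g g' : FreeGroup SoloInformedPGen) : Type := PresentedGroup (SoloInformedPGen.pairRels φ g g')

namespace SoloInformedPairGroup

open SoloInformedPGen

variable {φ g g' : FreeGroup SoloInformedPGen}

/-- The generator `a` of `G(φ; g, g')`. -/
def ga : SoloInformedPairGroup φ g g' := PresentedGroup.of SoloInformedPGen.a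
/-- The generator `b` of `G(φ; g, g')`. -/
def gb : SoloInformedPairGroup φ g g' := PresentedGroup.of SoloInformedPGen.b

/-- The relators hold in the presented group. -/
theorem rel_eq_one (k : Fin 6) : (PresentedGroup.mk (pairRels φ g g') (pairRel φ g g' k) : SoloInformedPairGroup φ g g') = 1 :=
  (QuotientGroup.eq_one_iff _).2 (Subgroup.subset_normalClosure ⟨k, rfl⟩)

/-- `a³ = abab` in `G(φ; g, g')`. -/
theorem r0 : (ga * ga * ga : SoloInformedPairGroup φ g g') = ga * gb * ga * gb := by
  have h := rel_eq_one (φ := φ) (g := g) (g' := g') 0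
  rw [← mul_inv_eq_one]
  simpa [pairRel, A, B, ga, gb, PresentedGroup.of, mul_assoc] using h

/-- `b⁷ = abab` in `G(φ; g, g')`. -/
theorem r2 : (gb * gb * gb * gb * gb * gb * gb : SoloInformedPairGroup φ g g') = ga * gb * ga * gb := by
  have h := rel_eq_one (φ := φ) (g := g) (g' := g') 1
  rw [← mul_inv_eq_one]
  simpa [pairRel, A, B, ga, gb, PresentedGroup.of, mul_assoc] using h

/-- In a FREE pair group the page generators would die. -/
theorem ga_eq_one_of_free (hfree : IsFreeGroup (SoloInformedPairGroup φ g g')) : (ga : SoloInformedPairGroup φ g g') = 1 :=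
  (soloInformed_free_no237 (H := SoloInformedPairGroup φ g g') (z := ga * gb * ga * gb) r0 rfl r2).1

/-- NON-FREENESS CRITERION: a homomorphism to any group under which `a` survives shows `G(φ; g, g')` is not free. -/
theorem not_isFreeGroup_of_hom {T : Type*} [Group T] (ψ : SoloInformedPairGroup φ g g' →* T) (h : ψ ga ≠ 1) :
    ¬ IsFreeGroup (SoloInformedPairGroup φ g g') := fun hfree =>
  h (by rw [ga_eq_one_of_free hfree, map_one])

end SoloInformedPairGroup

/-! #### Vertex `a`: the pair `(T_b, T_{aba⁻¹})` of the three-torus presentation, `φ = a`, `g = b`, `g' = aba⁻¹` -/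

namespace SoloInformedPairA
open SoloInformedPGen

/-- `φ = a`. -/
def φw : FreeGroup SoloInformedPGen := A
/-- `g = b`. -/
def gw : FreeGroup SoloInformedPGen := B
/-- `g' = aba⁻¹`. -/
def g'w : FreeGroup SoloInformedPGen := A * B * A⁻¹

/-- The certificate assignment composed with `Γ̃ → PSL(2,8)`: `a ↦ ā`, `b ↦ b̄`, `x₁ ↦ u = b̄`,
`x₂ ↦ u v u⁻¹ = b̄ (ā b̄ ā⁻¹) b̄⁻¹` (`v = aba⁻¹`). -/
def img : SoloInformedPGen → Equiv.Perm (Fin 9)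
  | .a => soloInformedPermA
  | .b => soloInformedPermB
  | .x₁ => soloInformedPermB
  | .x₂ => soloInformedPermB * (soloInformedPermA * soloInformedPermB * soloInformedPermA⁻¹) * soloInformedPermB⁻¹

set_option maxRecDepth 20000 in
/-- The images satisfy the six relators (a finite check in `S₉`). -/
theorem lift_rel (k : Fin 6) : FreeGroup.lift img (pairRel φw gw g'w k) = 1 := by
  fin_cases k <;> simp [pairRel, φw, gw, g'w, A, B, X₁, X₂, img] <;> decide

/-- The certificate homomorphism `G(a; b, aba⁻¹) → PSL(2,8) ≤ S₉`. -/
def ψ : SoloInformedPairGroup φw gw g'w →* Equiv.Perm (Fin 9) :=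
  PresentedGroup.toGroup (f := img) (by rintro _ ⟨k, rfl⟩; exact lift_rel k)

/-- Value of the certificate homomorphism on the generator `a`. -/
theorem ψ_ga : ψ SoloInformedPairGroup.ga = soloInformedPermA := PresentedGroup.toGroup.of _

/-- The group of the two-level pair `(T_b × θ₁, T_{aba⁻¹} × θ₂)` in `X(a) = (S⁴, τ³T(2,7))` is NOT free;
in particular that pair of unknotted page tori — two of the three tori of `X(η) = X(a·b⁻²(aba⁻¹)²b⁻³)` — is not split. -/
theorem not_isFreeGroup : ¬ IsFreeGroup (SoloInformedPairGroup φw gw g'w) :=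
  SoloInformedPairGroup.not_isFreeGroup_of_hom ψ (by rw [ψ_ga]; exact soloInformed_psl28_hurwitz.2.2.2)

end SoloInformedPairA

/-! #### Vertex `b`, antipodal type: `φ = b`, `g = g₀ = ab⁻³`, `g' = g₃ = b³ g₀ b⁻³` -/

namespace SoloInformedPairB
open SoloInformedPGen

/-- `φ = b`. -/
def φw : FreeGroup SoloInformedPGen := B
/-- `g = g₀ = ab⁻³` (tunnel class of `τ⁷T(2,3)`). -/
def gw : FreeGroup SoloInformedPGen := A * B⁻¹ * B⁻¹ * B⁻¹
/-- `g' = g₃ = b³ g₀ b⁻³`. -/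
def g'w : FreeGroup SoloInformedPGen := B * B * B * (A * B⁻¹ * B⁻¹ * B⁻¹) * (B⁻¹ * B⁻¹ * B⁻¹)

/-- `ḡ₀` in `PSL(2,8)`. -/
def pg₀ : Equiv.Perm (Fin 9) := soloInformedPermA * soloInformedPermB⁻¹ * soloInformedPermB⁻¹ * soloInformedPermB⁻¹
/-- `ḡ₃` in `PSL(2,8)`. -/
def pg₃ : Equiv.Perm (Fin 9) :=
  soloInformedPermB * soloInformedPermB * soloInformedPermB * pg₀ * soloInformedPermB⁻¹ * soloInformedPermB⁻¹ * soloInformedPermB⁻¹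

/-- The certificate assignment composed with `Γ̃ → PSL(2,8)`: `x₁ ↦ u = ḡ₀⁻¹`, `x₂ ↦ u v u⁻¹` with `v = ḡ₃⁻¹`
(so `x₂x₁ ↦ uv = b̄` by `SoloInformed_cert_antipodal`). -/
def img : SoloInformedPGen → Equiv.Perm (Fin 9)
  | .a => soloInformedPermA
  | .b => soloInformedPermB
  | .x₁ => pg₀⁻¹
  | .x₂ => pg₀⁻¹ * pg₃⁻¹ * pg₀

set_option maxRecDepth 20000 in
/-- The images satisfy the six relators (a finite check in `S₉`). -/
theorem lift_rel (k : Fin 6) : FreeGroup.lift img (pairRel φw gw g'w k) = 1 := by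
  fin_cases k <;> simp [pairRel, φw, gw, g'w, A, B, X₁, X₂, img] <;> decide

/-- The certificate homomorphism `G(b; g₀, g₃) → PSL(2,8) ≤ S₉`. -/
def ψ : SoloInformedPairGroup φw gw g'w →* Equiv.Perm (Fin 9) :=
  PresentedGroup.toGroup (f := img) (by rintro _ ⟨k, rfl⟩; exact lift_rel k)

/-- Value of the certificate homomorphism on the generator `a`. -/
theorem ψ_ga : ψ SoloInformedPairGroup.ga = soloInformedPermA := PresentedGroup.toGroup.of _

/-- The group of the ANTIPODAL two-level pair of tunnel page tori `(T_{g₀} × θ₁, T_{g₃} × θ₂)` in `X(b) = (S⁴, τ⁷T(2,3))`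
is NOT free; in particular that pair of smoothly unknotted tori is not split (C604, type `d = 3`; the types `d = 2, 5`
of the banked pair `P*` have free group and are undecided). -/
theorem not_isFreeGroup : ¬ IsFreeGroup (SoloInformedPairGroup φw gw g'w) :=
  SoloInformedPairGroup.not_isFreeGroup_of_hom ψ (by rw [ψ_ga]; exact soloInformed_psl28_hurwitz.2.2.2)

end SoloInformedPairB

end Summit.SmoothPoincare4.SmoothPoincare4.Theorems
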